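import Summits.AtomisticToContinuum.FouriersLaw.Theses.ContactStieltjesMeasure
import Summits.AtomisticToContinuum.FouriersLaw.Theorems.ContactMeasureLimit.Negative.FalseWithoutResponse

/-!
# Disproof of `ContactMeasureLimit` (stmt-AtomisticToContinuum-15250) — findings

Crux (M) of route `ContactStieltjesMeasure`: for `pinnedChain ω₂ lam β γ` (`ω₂, lam, β > 0`), `T > 0` and
every family `Φ : ℕ → ℝ → ℝ` that is STRUCTURAL (each `Φ N`, `N ≥ 2`, monotone, `= 0` on `(-∞,0]`,
bounded above) and REPRESENTS the linear response at EVERY friction `γ > 0`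
(`J_N(T,δ)/δ → (N-1)·γ·∫₀^∞ Φ_N k_γ`, `k_γ(t) = 2t/(γ²+t²)²`), there is a monotone `M` with
`N·Φ_N(t) → M(t)` at every continuity point `t > 0` of `M`.

VERDICT OF THIS CYCLE: NO KILL, and a structural reason why none is available short of refuting the
conjunct — see §3: `FouriersLaw → StieltjesContinuity → ContactMeasureLimit` is PROVED below
(`contactMeasureLimit_of_fouriersLaw`), where `StieltjesContinuity` is the registered pure-analysis
stub of both lines (`birth`, `escape-import`; child 1 of SPLIT-PROPOSAL.md), checked TRUE on paper in
§4. Hence `¬ContactMeasureLimit → ¬FouriersLaw` (`not_fouriersLaw_of_not_contactMeasureLimit`): every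
counterexample to (M) is a counterexample to Fourier's law for the pinned anharmonic chain itself.
(Strategist b1 recorded the same conclusion informally, STRATEGY-CENSUS.md §N-1; here it is a theorem.)

WHAT IS LOAD-BEARING (negative lemmas, all sorry-free; the landed ones are cited by tree path):
* §0 the RESPONSE clause — `Theorems/ContactMeasureLimit/Negative/FalseWithoutResponse.lean`
  (`contactMeasureLimit_false_without_response`, landed before this seat; imported, not restated).
* §1 the `∀ γ` in the response clause — `not_contactMeasureLimitOfOneFriction`: replacing "represents
  the response at every friction" by CONVERGENCE of the represented conductance at ONE friction `γ₀`
  (any `γ₀ > 0`), even together with the upper density (U) `N·Φ_N(t) ≤ C(1+t)`, does NOT give (M):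
  two step profiles (`δ₀` and `2δ_{γ₀}` in contact-measure language) have the same transform at `γ₀`,
  and alternating them in the parity of `N` kills convergence at EVERY `t > 0`. Any proof must use the
  response identity on a uniqueness set of frictions (a window / a progression in `γ²`, Widder VIII.5a),
  never finitely many.
* §2 the proviso "at continuity points of `M`" in the CONCLUSION — `not_stieltjesContinuityEverywhere`:
  with transforms converging at EVERY friction and `0 ≤ F_N ≤ 1`, convergence can still fail at a
  point (atoms at `1 ± 1/(N+2)` alternating in parity): the conclusion of (M) / of the stub cannot be
  strengthened to "for all `t > 0`", nor to "`M` continuous".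
* §3 WHY IT RESISTS: `contactMeasureLimit_of_fouriersLaw`, `not_fouriersLaw_of_not_contactMeasureLimit`.
* §4 TARGETS (the PICKED line `IdeatorOneSketch`, skeleton `Lines/IdeatorOneSketch.lean`): its four
  analysis stubs `stub_layerCake`, `stub_truncatedConvergence`, `stub_escapedMassConstant`,
  `stub_limitRepresentation` were attacked on paper for misstatement and found TRUE as stated (A1, A2,
  A4 have meanwhile LANDED as `Theorems/ContactStieltjesMeasureContactMeasureLimitStub*.lean`); the two
  physics stubs are items 12238 / 10924 BY NAME, both consequences of `FouriersLaw` — no stub kill.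
* §5 NEAR-MISS / not attempted in Lean: the harmonic corner `lam = β = 0` (needs the harmonic K2).

LANDED through the gate from this file (def-free restatements, same proofs):
`Theorems/ContactMeasureLimit/Negative/OneFrictionAndPointwise.lean` (p159379) =
§1 `contactMeasureLimit_false_of_one_friction` + §2 `stieltjesContinuity_false_everywhere`.
-/

noncomputable section

namespace Summit.AtomisticToContinuum.FouriersLaw.Cruxes.ContactMeasureLimit.Disproof

open MeasureTheory Filter Set Topology
open Summit.AtomisticToContinuum.FouriersLaw.Theses.ContactStieltjesMeasure
open Summit.AtomisticToContinuum.FouriersLaw.Theorems.ContactMeasureLimit.Negative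
  (exists_pos_continuousAt_of_monotone)

/-! ## 0. Toolkit: the contact kernel against step profiles -/

/-- The contact kernel `k_γ(t) = 2t/(γ²+t²)² = -∂_t (γ²+t²)⁻¹`. -/
def contactKernel (γ t : ℝ) : ℝ := 2 * t / (γ ^ 2 + t ^ 2) ^ 2

lemma contactKernel_nonneg (γ : ℝ) {s : ℝ} (hs : 0 ≤ s) : 0 ≤ contactKernel γ s := by
  unfold contactKernel; positivity

lemma hasDerivAt_negInv {γ : ℝ} (hγ : 0 < γ) (s : ℝ) :
    HasDerivAt (fun x : ℝ => -(γ ^ 2 + x ^ 2)⁻¹) (contactKernel γ s) s := by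
  have hpos : 0 < γ ^ 2 + s ^ 2 := by positivity
  have h1 : HasDerivAt (fun x : ℝ => γ ^ 2 + x ^ 2) (2 * s) s := by
    simpa using ((hasDerivAt_pow 2 s).const_add (γ ^ 2))
  refine (h1.inv hpos.ne').neg.congr_deriv ?_
  unfold contactKernel
  rw [neg_div, neg_neg]

lemma tendsto_negInv (γ : ℝ) : Tendsto (fun x : ℝ => -(γ ^ 2 + x ^ 2)⁻¹) atTop (𝓝 0) := by
  have h : Tendsto (fun x : ℝ => γ ^ 2 + x ^ 2) atTop atTop :=
    tendsto_atTop_add_const_left _ _ (tendsto_pow_atTop two_ne_zero)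
  simpa using (tendsto_inv_atTop_zero.comp h).neg

/-- `∫_a^∞ k_γ = (γ² + a²)⁻¹` for `a ≥ 0` (with integrability). -/
lemma integral_Ioi_contactKernel {γ : ℝ} (hγ : 0 < γ) {a : ℝ} (ha : 0 ≤ a) :
    IntegrableOn (contactKernel γ) (Ioi a) ∧
      ∫ s in Ioi a, contactKernel γ s = (γ ^ 2 + a ^ 2)⁻¹ := by
  have hcont : ContinuousWithinAt (fun x : ℝ => -(γ ^ 2 + x ^ 2)⁻¹) (Ici a) a := by
    refine (Continuous.neg (Continuous.inv₀ (by fun_prop) (fun x => ?_))).continuousWithinAt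
    positivity
  have hderiv : ∀ x ∈ Ioi a,
      HasDerivAt (fun x : ℝ => -(γ ^ 2 + x ^ 2)⁻¹) (contactKernel γ x) x :=
    fun x _ => hasDerivAt_negInv hγ x
  have hnn : ∀ x ∈ Ioi a, 0 ≤ contactKernel γ x :=
    fun x hx => contactKernel_nonneg γ (ha.trans (le_of_lt hx))
  have hint : IntegrableOn (contactKernel γ) (Ioi a) :=
    integrableOn_Ioi_deriv_of_nonneg hcont hderiv hnn (tendsto_negInv γ)
  refine ⟨hint, ?_⟩
  rw [integral_Ioi_of_hasDerivAt_of_tendsto hcont hderiv hint (tendsto_negInv γ)]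
  ring

/-- Step profile: `stepDF c a = c·1_{(a,∞)}` — in contact-measure language an atom of mass `c` at
`s = a`. -/
def stepDF (c a : ℝ) (t : ℝ) : ℝ := if a < t then c else 0

lemma stepDF_monotone {c : ℝ} (hc : 0 ≤ c) (a : ℝ) : Monotone (stepDF c a) := by
  intro x y hxy
  unfold stepDF
  split_ifs with hx hy
  · exact le_rfl
  · exact absurd (lt_of_lt_of_le hx hxy) hy
  · exact hc
  · exact le_rfl

lemma stepDF_of_nonpos {c a : ℝ} (ha : 0 ≤ a) {s : ℝ} (hs : s ≤ 0) : stepDF c a s = 0 := by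
  unfold stepDF
  rw [if_neg (not_lt.2 (hs.trans ha))]

lemma stepDF_le {c : ℝ} (hc : 0 ≤ c) (a s : ℝ) : stepDF c a s ≤ c := by
  unfold stepDF; split_ifs <;> linarith

lemma stepDF_nonneg {c : ℝ} (hc : 0 ≤ c) (a s : ℝ) : 0 ≤ stepDF c a s := by
  unfold stepDF; split_ifs <;> linarith

/-- The transform of a step: `∫₀^∞ c·1_{(a,∞)} k_γ = c/(γ²+a²)` (`a ≥ 0`). -/
lemma integral_stepDF_mul_kernel {γ : ℝ} (hγ : 0 < γ) (c : ℝ) {a : ℝ} (ha : 0 ≤ a) :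
    ∫ t in Ioi (0 : ℝ), stepDF c a t * (2 * t / (γ ^ 2 + t ^ 2) ^ 2) = c / (γ ^ 2 + a ^ 2) := by
  have h1 : (fun t : ℝ => stepDF c a t * (2 * t / (γ ^ 2 + t ^ 2) ^ 2)) =
      (Ioi a).indicator (fun t : ℝ => c * contactKernel γ t) := by
    funext t
    simp only [stepDF, indicator, mem_Ioi, contactKernel]
    split_ifs <;> ring
  rw [h1, setIntegral_indicator measurableSet_Ioi, Ioi_inter_Ioi, sup_eq_right.2 ha,
    integral_const_mul, (integral_Ioi_contactKernel hγ ha).2, div_eq_mul_inv]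

/-- A real sequence equal to `a` along the even and to `b` along the odd integers, `|a - b| ≥ 1`,
has no limit. -/
lemma not_tendsto_of_even_odd {u : ℕ → ℝ} {a b : ℝ} (hab : 1 ≤ |a - b|)
    (he : ∀ k : ℕ, 1 ≤ k → u (2 * k) = a) (ho : ∀ k : ℕ, 1 ≤ k → u (2 * k + 1) = b) (m : ℝ) :
    ¬ Tendsto u atTop (𝓝 m) := by
  intro h
  have hev : ∀ᶠ N in atTop, dist (u N) m < 1 / 2 :=
    (Metric.tendsto_nhds.1 h) (1 / 2) (by norm_num)
  obtain ⟨N₀, hN₀⟩ := eventually_atTop.1 hev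
  have h1 := hN₀ (2 * (N₀ + 1)) (by omega)
  have h2 := hN₀ (2 * (N₀ + 1) + 1) (by omega)
  rw [he (N₀ + 1) (by omega), Real.dist_eq] at h1
  rw [ho (N₀ + 1) (by omega), Real.dist_eq] at h2
  have h3 : |a - b| ≤ |a - m| + |b - m| := by
    calc |a - b| = |(a - m) - (b - m)| := by ring_nf
      _ ≤ |a - m| + |b - m| := abs_sub _ _
  linarith

lemma not_even_two_mul_add_one (k : ℕ) : ¬ Even (2 * k + 1) :=
  fun h => (Nat.even_add_one.1 h) (even_two_mul k)

/-! ## 1. The `∀ γ` is load-bearing: ONE friction (plus the upper density) does not give (M) -/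

/-- (M) FROM ONE FRICTION — the crux with its all-friction response clause replaced by what Fourier's
law would give at a SINGLE friction `γ₀`: convergence of the represented response coefficients
`(N-1)·γ₀·∫₀^∞ Φ_N k_{γ₀}`; the upper density (U) of crux `ContactUpperDensity` is thrown in as an
extra hypothesis. FALSE for every `γ₀ > 0` (`not_contactMeasureLimitOfOneFriction`). -/
def ContactMeasureLimitOfOneFriction (γ₀ : ℝ) : Prop :=
  ∀ Φ : ℕ → ℝ → ℝ,
    (∀ N : ℕ, 2 ≤ N →
        Monotone (Φ N) ∧ (∀ s : ℝ, s ≤ 0 → Φ N s = 0) ∧ (∃ m : ℝ, ∀ s : ℝ, Φ N s ≤ m)) →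
    (∃ κ : ℝ, Tendsto (fun N : ℕ => ((N : ℝ) - 1) * γ₀ *
        ∫ t in Ioi (0 : ℝ), Φ N t * (2 * t / (γ₀ ^ 2 + t ^ 2) ^ 2)) atTop (𝓝 κ)) →
    (∃ C : ℝ, ∃ N₀ : ℕ, ∀ N : ℕ, N₀ ≤ N → ∀ t : ℝ, 0 < t → (N : ℝ) * Φ N t ≤ C * (1 + t)) →
    ∃ M : ℝ → ℝ, Monotone M ∧ ∀ t : ℝ, 0 < t → ContinuousAt M t →
      Tendsto (fun N : ℕ => (N : ℝ) * Φ N t) atTop (𝓝 (M t))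

/-- The parity-alternating witness: `N·Φ_N = 1_{(0,∞)}` for even `N`, `= 2·1_{(γ₀,∞)}` for odd `N`. -/
def oneFrictionWitness (γ₀ : ℝ) (N : ℕ) (t : ℝ) : ℝ :=
  if Even N then stepDF (1 / N) 0 t else stepDF (2 / N) γ₀ t

lemma oneFrictionWitness_transform {γ₀ : ℝ} (hγ₀ : 0 < γ₀) (N : ℕ) :
    ((N : ℝ) - 1) * γ₀ *
        ∫ t in Ioi (0 : ℝ), oneFrictionWitness γ₀ N t * (2 * t / (γ₀ ^ 2 + t ^ 2) ^ 2) =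
      ((N : ℝ) - 1) / N * γ₀⁻¹ := by
  unfold oneFrictionWitness
  have hγ2 : γ₀ ^ 2 ≠ 0 := by positivity
  split_ifs with hN
  · rw [integral_stepDF_mul_kernel hγ₀ _ le_rfl]
    field_simp
    ring
  · rw [integral_stepDF_mul_kernel hγ₀ _ hγ₀.le]
    field_simp
    ring

/-- **ONE FRICTION IS NOT ENOUGH.** For every `γ₀ > 0`, `ContactMeasureLimitOfOneFriction γ₀` fails:
the family `oneFrictionWitness γ₀` is structural, its represented response coefficient at `γ₀` is
`((N-1)/N)·γ₀⁻¹ → γ₀⁻¹` for both parities (the contact measures `δ₀` and `2δ_{γ₀}` have the same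
transform `γ₀∫dμ/(γ₀²+s²) = γ₀⁻¹`), `N·Φ_N ≤ 2 ≤ 2(1+t)`, yet `N·Φ_N(t)` alternates `1,0,1,0,…`
(`t ≤ γ₀`) or `1,2,1,2,…` (`t > γ₀`) at EVERY `t > 0`, so no monotone `M` works (a monotone `M` has a
continuity point in `(0,∞)`). [folklore] -/
theorem not_contactMeasureLimitOfOneFriction {γ₀ : ℝ} (hγ₀ : 0 < γ₀) :
    ¬ ContactMeasureLimitOfOneFriction γ₀ := by
  intro h
  set Φ := oneFrictionWitness γ₀ with hΦdef
  have hstruct : ∀ N : ℕ, 2 ≤ N →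
      Monotone (Φ N) ∧ (∀ s : ℝ, s ≤ 0 → Φ N s = 0) ∧ (∃ m : ℝ, ∀ s : ℝ, Φ N s ≤ m) := by
    intro N _
    by_cases hN : Even N
    · have e : Φ N = stepDF (1 / N) 0 := by
        funext t; simp [hΦdef, oneFrictionWitness, hN]
      rw [e]
      exact ⟨stepDF_monotone (by positivity) 0, fun s hs => stepDF_of_nonpos le_rfl hs,
        ⟨1 / N, fun s => stepDF_le (by positivity) 0 s⟩⟩
    · have e : Φ N = stepDF (2 / N) γ₀ := by
        funext t; simp [hΦdef, oneFrictionWitness, hN]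
      rw [e]
      exact ⟨stepDF_monotone (by positivity) γ₀, fun s hs => stepDF_of_nonpos hγ₀.le hs,
        ⟨2 / N, fun s => stepDF_le (by positivity) γ₀ s⟩⟩
  have hconv : ∃ κ : ℝ, Tendsto (fun N : ℕ => ((N : ℝ) - 1) * γ₀ *
      ∫ t in Ioi (0 : ℝ), Φ N t * (2 * t / (γ₀ ^ 2 + t ^ 2) ^ 2)) atTop (𝓝 κ) := by
    refine ⟨1 * γ₀⁻¹, ?_⟩
    have hfrac : Tendsto (fun N : ℕ => ((N : ℝ) - 1) / N) atTop (𝓝 1) := by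
      have h1 : Tendsto (fun N : ℕ => (1 : ℝ) - 1 / (N : ℝ)) atTop (𝓝 (1 - 0)) :=
        tendsto_const_nhds.sub tendsto_one_div_atTop_nhds_zero_nat
      rw [sub_zero] at h1
      refine h1.congr' ?_
      filter_upwards [eventually_gt_atTop 0] with N hN
      have hN' : (N : ℝ) ≠ 0 := by exact_mod_cast hN.ne'
      field_simp
    refine (hfrac.mul_const γ₀⁻¹).congr' (Eventually.of_forall fun N => ?_)
    exact (oneFrictionWitness_transform hγ₀ N).symm
  have hUD : ∃ C : ℝ, ∃ N₀ : ℕ, ∀ N : ℕ, N₀ ≤ N → ∀ t : ℝ, 0 < t →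
      (N : ℝ) * Φ N t ≤ C * (1 + t) := by
    refine ⟨2, 1, fun N hN t ht => ?_⟩
    have hNpos : (0 : ℝ) < N := by exact_mod_cast hN
    have hle : (N : ℝ) * Φ N t ≤ 2 := by
      simp only [hΦdef, oneFrictionWitness]
      split_ifs with hE
      · calc (N : ℝ) * stepDF (1 / N) 0 t ≤ N * (1 / N) :=
              mul_le_mul_of_nonneg_left (stepDF_le (by positivity) 0 t) hNpos.le
          _ = 1 := by field_simp
          _ ≤ 2 := by norm_num
      · calc (N : ℝ) * stepDF (2 / N) γ₀ t ≤ N * (2 / N) :=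
              mul_le_mul_of_nonneg_left (stepDF_le (by positivity) γ₀ t) hNpos.le
          _ = 2 := by field_simp
    nlinarith
  obtain ⟨M, hMmono, hM⟩ := h Φ hstruct hconv hUD
  obtain ⟨t, ht, hcont⟩ := exists_pos_continuousAt_of_monotone hMmono
  have hlim := hM t ht hcont
  -- along even `N = 2k ≥ 2` the value is `1`
  have heven : ∀ k : ℕ, 1 ≤ k → ((2 * k : ℕ) : ℝ) * Φ (2 * k) t = 1 := by
    intro k hk
    have hE : Even (2 * k) := even_two_mul k
    have hpos : (0 : ℝ) < ((2 * k : ℕ) : ℝ) := by positivity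
    simp only [hΦdef, oneFrictionWitness, if_pos hE, stepDF, if_pos ht]
    field_simp
  by_cases htγ : t ≤ γ₀
  · -- odd `N`: value `0`
    have hodd : ∀ k : ℕ, 1 ≤ k → ((2 * k + 1 : ℕ) : ℝ) * Φ (2 * k + 1) t = 0 := by
      intro k _
      simp only [hΦdef, oneFrictionWitness, if_neg (not_even_two_mul_add_one k), stepDF,
        if_neg (not_lt.2 htγ), mul_zero]
    exact not_tendsto_of_even_odd (a := 1) (b := 0) (by norm_num) heven hodd (M t) hlim
  · -- odd `N`: value `2`
    have hodd : ∀ k : ℕ, 1 ≤ k → ((2 * k + 1 : ℕ) : ℝ) * Φ (2 * k + 1) t = 2 := by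
      intro k _
      have hpos : (0 : ℝ) < ((2 * k + 1 : ℕ) : ℝ) := by positivity
      simp only [hΦdef, oneFrictionWitness, if_neg (not_even_two_mul_add_one k), stepDF,
        if_pos (not_le.1 htγ)]
      field_simp
    exact not_tendsto_of_even_odd (a := 1) (b := 2) (by norm_num) heven hodd (M t) hlim

/-! ## 2. The conclusion cannot be strengthened to convergence at every `t > 0` -/

/-- The registered analysis stub of the crux (lines `birth`, `escape-import`; IdeatorOneSketch's
`StieltjesContinuity`, child 1 of SPLIT-PROPOSAL.md) with its conclusion STRENGTHENED from "at the
continuity points of `M`" to "at every `t > 0`". FALSE (`not_stieltjesContinuityEverywhere`). -/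
def StieltjesContinuityEverywhere : Prop :=
  ∀ F : ℕ → ℝ → ℝ, (∀ N : ℕ, Monotone (F N) ∧ (∀ s : ℝ, s ≤ 0 → F N s = 0) ∧
    (∃ m : ℝ, ∀ s : ℝ, F N s ≤ m)) →
    (∀ γ : ℝ, 0 < γ → ∃ L : ℝ, Tendsto
      (fun N : ℕ => ∫ t in Ioi (0 : ℝ), F N t * (2 * t / (γ ^ 2 + t ^ 2) ^ 2)) atTop (𝓝 L)) →
    ∃ M : ℝ → ℝ, Monotone M ∧ ∀ t : ℝ, 0 < t →
      Tendsto (fun N : ℕ => F N t) atTop (𝓝 (M t))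

/-- Atom positions `1 + 1/(N+2)` (even `N`) / `1 - 1/(N+2)` (odd `N`): they straddle `1` and `→ 1`. -/
def straddle (N : ℕ) : ℝ := if Even N then 1 + 1 / ((N : ℝ) + 2) else 1 - 1 / ((N : ℝ) + 2)

lemma straddle_pos (N : ℕ) : 0 < straddle N := by
  unfold straddle
  have h2 : (0 : ℝ) < (N : ℝ) + 2 := by positivity
  have h3 : 1 / ((N : ℝ) + 2) ≤ 1 / 2 :=
    one_div_le_one_div_of_le (by norm_num) (by linarith [Nat.cast_nonneg (α := ℝ) N])
  split_ifs
  · positivity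
  · linarith

lemma abs_straddle_sub_one (N : ℕ) : |straddle N - 1| = 1 / ((N : ℝ) + 2) := by
  unfold straddle
  have h2 : (0 : ℝ) < 1 / ((N : ℝ) + 2) := by positivity
  split_ifs
  · rw [add_sub_cancel_left, abs_of_pos h2]
  · rw [sub_sub_cancel_left, abs_neg, abs_of_pos h2]

lemma tendsto_straddle : Tendsto straddle atTop (𝓝 1) := by
  refine Metric.tendsto_atTop.2 fun ε hε => ?_
  obtain ⟨N₀, hN₀⟩ := exists_nat_gt (1 / ε)
  refine ⟨N₀, fun N hN => ?_⟩
  rw [Real.dist_eq, abs_straddle_sub_one]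
  have hN' : (1 / ε : ℝ) < (N : ℝ) + 2 := by
    have : (N₀ : ℝ) ≤ N := by exact_mod_cast hN
    linarith
  have hpos : (0 : ℝ) < (N : ℝ) + 2 := by positivity
  rw [div_lt_iff₀ hpos]
  rw [div_lt_iff₀ hε] at hN'
  linarith

/-- The witness `F_N = 1_{(straddle N, ∞)}`: unit atoms at `1 ± 1/(N+2)`. -/
def everywhereWitness (N : ℕ) (t : ℝ) : ℝ := stepDF 1 (straddle N) t

/-- **CONVERGENCE AT EVERY POINT IS TOO MUCH.** `StieltjesContinuityEverywhere` fails: for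
`F_N = 1_{(1 ± 1/(N+2), ∞)}` (sign by parity) every transform converges (`(γ² + (1±1/(N+2))²)⁻¹ →
(γ²+1)⁻¹`), `0 ≤ F_N ≤ 1`, but `F_N(1) = 0, 1, 0, 1, …`. A fortiori "`∃ M` monotone AND continuous"
is false, and so is the same strengthening of the crux's conclusion for any family `Φ_N = F_N/N`
obeying an abstract all-friction convergence hypothesis. The limit `1_{(1,∞)}` is recovered only at
its continuity points `t ≠ 1` — exactly the proviso in (M). [folklore] -/
theorem not_stieltjesContinuityEverywhere : ¬ StieltjesContinuityEverywhere := by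
  intro h
  have hstruct : ∀ N : ℕ, Monotone (everywhereWitness N) ∧
      (∀ s : ℝ, s ≤ 0 → everywhereWitness N s = 0) ∧ (∃ m : ℝ, ∀ s : ℝ, everywhereWitness N s ≤ m) :=
    fun N => ⟨stepDF_monotone zero_le_one _, fun s hs => stepDF_of_nonpos (straddle_pos N).le hs,
      ⟨1, fun s => stepDF_le zero_le_one _ s⟩⟩
  have htrans : ∀ γ : ℝ, 0 < γ → ∃ L : ℝ, Tendsto (fun N : ℕ =>
      ∫ t in Ioi (0 : ℝ), everywhereWitness N t * (2 * t / (γ ^ 2 + t ^ 2) ^ 2)) atTop (𝓝 L) := by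
    intro γ hγ
    refine ⟨1 / (γ ^ 2 + 1 ^ 2), ?_⟩
    have hne : γ ^ 2 + 1 ^ 2 ≠ 0 := by positivity
    have hlim : Tendsto (fun N : ℕ => 1 / (γ ^ 2 + straddle N ^ 2)) atTop
        (𝓝 (1 / (γ ^ 2 + 1 ^ 2))) :=
      Tendsto.div tendsto_const_nhds (tendsto_const_nhds.add (tendsto_straddle.pow 2)) hne
    refine hlim.congr fun N => ?_
    exact (integral_stepDF_mul_kernel hγ 1 (straddle_pos N).le).symm
  obtain ⟨M, -, hM⟩ := h everywhereWitness hstruct htrans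
  have hlim := hM 1 one_pos
  have heven : ∀ k : ℕ, 1 ≤ k → everywhereWitness (2 * k) 1 = 0 := by
    intro k _
    have hE : Even (2 * k) := even_two_mul k
    have hgt : ¬ straddle (2 * k) < 1 := by
      unfold straddle; rw [if_pos hE]; push Not
      have : (0 : ℝ) < 1 / (((2 * k : ℕ) : ℝ) + 2) := by positivity
      linarith
    simp [everywhereWitness, stepDF, hgt]
  have hodd : ∀ k : ℕ, 1 ≤ k → everywhereWitness (2 * k + 1) 1 = 1 := by
    intro k _
    have hlt : straddle (2 * k + 1) < 1 := by
      unfold straddle; rw [if_neg (not_even_two_mul_add_one k)]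
      have : (0 : ℝ) < 1 / (((2 * k + 1 : ℕ) : ℝ) + 2) := by positivity
      linarith
    simp [everywhereWitness, stepDF, hlt]
  exact not_tendsto_of_even_odd (a := 0) (b := 1) (by norm_num) heven hodd (M 1) hlim

/-! ## 3. Why it resists: (M) is a corollary of Fourier's law, modulo the (true) analysis stub -/

/-- VERBATIM copy of the registered analysis stub `StieltjesContinuity` (IdeatorOneSketch.lean §Target;
`stub_stieltjesContinuity` of lines `birth` / `escape-import`; child 1 of SPLIT-PROPOSAL.md): the
Stieltjes continuity theorem for the contact kernel. Checked TRUE on paper (§4); copied here only so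
that this work file does not import a sorried sketch. -/
def StieltjesContinuity : Prop :=
  ∀ F : ℕ → ℝ → ℝ, (∀ N : ℕ, Monotone (F N) ∧ (∀ s : ℝ, s ≤ 0 → F N s = 0) ∧
    (∃ m : ℝ, ∀ s : ℝ, F N s ≤ m)) →
    (∀ γ : ℝ, 0 < γ → ∃ L : ℝ, Filter.Tendsto
      (fun N : ℕ => ∫ t in Set.Ioi (0 : ℝ), F N t * (2 * t / (γ ^ 2 + t ^ 2) ^ 2))
      Filter.atTop (nhds L)) →
    ∃ M : ℝ → ℝ, Monotone M ∧ ∀ t : ℝ, 0 < t → ContinuousAt M t →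
      Filter.Tendsto (fun N : ℕ => F N t) Filter.atTop (nhds (M t))

open Literature.MathematicalPhysics.KineticTheory.HeatConduction (pinnedChain PhaseSpace) in
/-- **(M) FOLLOWS FROM FOURIER'S LAW** (modulo the analysis stub). If `FouriersLaw` holds then every
family `Φ` satisfying the crux's hypothesis has convergent scaled transforms at EVERY friction:
clause (i) of `FouriersLawFor` discharges the uniqueness premise and (by choice) supplies a
steady-state family, the `δ`-limit along `𝓝[≠] 0` is unique, so `D_N(γ) = (N-1)·γ·∫₀^∞ Φ_N k_γ`
(`N ≥ 2`) and `N·∫₀^∞ Φ_N k_γ = (N/(N-1))·D_N(γ)/γ → κ(T)/γ`; the stub applied to `F_N := N·Φ_N`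
(`N ≥ 2`, else `0`) gives `M`. CONSEQUENCE FOR DISPROVERS: a counterexample to (M) refutes the
conjunct (`not_fouriersLaw_of_not_contactMeasureLimit`). [folklore] -/
theorem contactMeasureLimit_of_fouriersLaw (hSC : StieltjesContinuity) (hFL : _root_.FouriersLaw) :
    ContactMeasureLimit := by
  intro ω₂ lam β hω hl hβ T hT Φ hΦ
  classical
  -- the scaled family, made structural at EVERY `N`
  let F : ℕ → ℝ → ℝ := fun N t => if 2 ≤ N then (N : ℝ) * Φ N t else 0
  have hF2 : ∀ N : ℕ, 2 ≤ N → ∀ t : ℝ, F N t = (N : ℝ) * Φ N t := fun N hN t => if_pos hN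
  have hFlt : ∀ N : ℕ, ¬ 2 ≤ N → ∀ t : ℝ, F N t = 0 := fun N hN t => if_neg hN
  have hstruct : ∀ N : ℕ, Monotone (F N) ∧ (∀ s : ℝ, s ≤ 0 → F N s = 0) ∧
      (∃ m : ℝ, ∀ s : ℝ, F N s ≤ m) := by
    intro N
    by_cases hN : 2 ≤ N
    · obtain ⟨hmono, hzero, ⟨m, hm⟩, -⟩ := hΦ N hN
      refine ⟨fun a b hab => ?_, fun s hs => ?_, ⟨(N : ℝ) * m, fun s => ?_⟩⟩
      · rw [hF2 N hN, hF2 N hN]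
        exact mul_le_mul_of_nonneg_left (hmono hab) (Nat.cast_nonneg N)
      · rw [hF2 N hN, hzero s hs, mul_zero]
      · rw [hF2 N hN]
        exact mul_le_mul_of_nonneg_left (hm s) (Nat.cast_nonneg N)
    · refine ⟨fun a b _ => ?_, fun s _ => hFlt N hN s, ⟨0, fun s => ?_⟩⟩
      · rw [hFlt N hN, hFlt N hN]
      · rw [hFlt N hN]
  -- the scaled transforms converge at every friction: Fourier's law AT THAT FRICTION
  have htrans : ∀ γ : ℝ, 0 < γ → ∃ L : ℝ, Tendsto
      (fun N : ℕ => ∫ t in Ioi (0 : ℝ), F N t * (2 * t / (γ ^ 2 + t ^ 2) ^ 2)) atTop (𝓝 L) := by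
    intro γ hγ
    obtain ⟨hEU, κ, -, hresp⟩ := hFL ω₂ lam β γ hω hl hβ hγ
    have huniq : ∀ (N' : ℕ) (T_L T_R : ℝ), 0 < T_L → 0 < T_R →
        ∀ μ ν : Measure (PhaseSpace N'),
          (pinnedChain ω₂ lam β γ).IsSteadyState N' T_L T_R μ →
            (pinnedChain ω₂ lam β γ).IsSteadyState N' T_L T_R ν → μ = ν := by
      intro N' T_L T_R hL hR μ ν hμ hν
      obtain ⟨μ₀, -, hall⟩ := hEU N' T_L T_R hL hR
      exact (hall μ hμ).trans (hall ν hν).symm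
    let μf : (N' : ℕ) → ℝ → ℝ → Measure (PhaseSpace N') := fun N' T_L T_R =>
      if h : 0 < T_L ∧ 0 < T_R then Classical.choose (hEU N' T_L T_R h.1 h.2) else 0
    have hμf : ∀ (N' : ℕ) (T_L T_R : ℝ), 0 < T_L → 0 < T_R →
        (pinnedChain ω₂ lam β γ).IsSteadyState N' T_L T_R (μf N' T_L T_R) := by
      intro N' T_L T_R hL hR
      simp only [μf, dif_pos (And.intro hL hR)]
      exact (Classical.choose_spec (hEU N' T_L T_R hL hR)).1
    obtain ⟨D, hD, hDlim⟩ := hresp μf hμf T hT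
    have hDN : ∀ N : ℕ, 2 ≤ N → D N = ((N : ℝ) - 1) * γ *
        ∫ t in Ioi (0 : ℝ), Φ N t * (2 * t / (γ ^ 2 + t ^ 2) ^ 2) :=
      fun N hN => tendsto_nhds_unique (hD N) ((hΦ N hN).2.2.2 γ hγ huniq μf hμf)
    have hfrac : Tendsto (fun N : ℕ => (N : ℝ) / ((N : ℝ) - 1)) atTop (𝓝 1) := by
      have h := tendsto_natCast_div_add_atTop (-1 : ℝ)
      refine h.congr fun N => ?_
      rw [← sub_eq_add_neg]
    refine ⟨1 * (κ T / γ), ?_⟩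
    refine (hfrac.mul (hDlim.div_const γ)).congr' ?_
    filter_upwards [eventually_ge_atTop 2] with N hN
    have hN1 : (N : ℝ) - 1 ≠ 0 := by
      have : (2 : ℝ) ≤ N := by exact_mod_cast hN
      linarith
    have hfun : (fun t : ℝ => F N t * (2 * t / (γ ^ 2 + t ^ 2) ^ 2)) =
        fun t : ℝ => (N : ℝ) * (Φ N t * (2 * t / (γ ^ 2 + t ^ 2) ^ 2)) := by
      funext t; rw [hF2 N hN]; ring
    rw [hfun, integral_const_mul, hDN N hN]
    generalize (∫ t in Ioi (0 : ℝ), Φ N t * (2 * t / (γ ^ 2 + t ^ 2) ^ 2)) = I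
    rw [mul_assoc (((N : ℝ) - 1)) γ I, mul_comm γ I, ← mul_assoc, mul_div_assoc,
      div_self hγ.ne', mul_one, ← mul_assoc, div_mul_cancel₀ _ hN1]
  obtain ⟨M, hMmono, hM⟩ := hSC F hstruct htrans
  refine ⟨M, hMmono, fun t ht hcont => ?_⟩
  refine (hM t ht hcont).congr' ?_
  filter_upwards [eventually_ge_atTop 2] with N hN
  exact hF2 N hN t

/-- **CONTRAPOSITIVE — the disprover's bottom line.** Modulo the analysis stub (a theorem of real
analysis, §4), a refutation of crux (M) is a refutation of the conjunct `FouriersLaw` for the pinned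
anharmonic chain: (M) carries no risk of its own. [folklore] -/
theorem not_fouriersLaw_of_not_contactMeasureLimit (hSC : StieltjesContinuity)
    (h : ¬ ContactMeasureLimit) : ¬ _root_.FouriersLaw :=
  fun hFL => h (contactMeasureLimit_of_fouriersLaw hSC hFL)

/-! ## 4. Targets — the PICKED line `IdeatorOneSketch` (no payload targets yet; pre-emptive check)

The lead's skeleton `Cruxes/ContactMeasureLimit/Lines/IdeatorOneSketch.lean` (sorry only in `stub_*`)
has four ANALYSIS stubs A1 `stub_layerCake`, A2 `stub_truncatedConvergence`, A3
`stub_escapedMassConstant`, A4 `stub_limitRepresentation` and two PHYSICS stubs by name (P1 = 12238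
`EscapeNonOscillation`, P2 = 10924 `BoundedResponse`). All four analysis stubs were attacked ON PAPER
for misstatement (degenerate `G`, atoms at `0⁺`, unbounded limits, missing uniformity) and survive;
A1, A2, A4 have since landed. Notes per stub:

* A2 `stub_truncatedConvergence` — `G` is NOT assumed `≥ 0` or `= 0` on `(-∞,0]`, but at continuity
  points `G = lim F_N ≥ 0` and these are dense in `(0,∞)`, so `0 ≤ G ≤ C` on `(0,R]` by monotonicity;
  the majorant `F_N(t) ≤ F_N(R) ≤ C_R` on `(0,R]` is uniform; a.e. convergence off the countable jump
  set. TRUE (landed).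
* A3 `stub_escapedMassConstant` — assumes NO pointwise convergence and NO uniform bound, only
  convergence of full and truncated transforms; still TRUE: `τ_N(R,γ) = ∫_{(R,∞)} F_N k_γ ≥ 0` gives
  `e(γ,R) := L γ - ∫_{(0,R]} G k_γ ≥ 0`, non-increasing in `R` because `G ≥ 0` on `(0,∞)` (monotone,
  `= 0` on `(-∞,0]` — this hypothesis IS used here), so `∫_{(0,R]} G k_γ ↑ L γ - e(γ)` (monotone
  convergence ⇒ integrability) and `e(γ') ≤ (1+ε) e(γ)` from `k_γ' ≤ (1+ε) k_γ` on `[R₀,∞)`. The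
  boundedness conjunct of `F N` is unused (harmless).
* A1 `stub_layerCake` / the sketch's `layer_cake` — `∫ (γ²+s²)⁻¹ dμ_F = ∫₀^∞ F k_γ` with `μ_F` the Stieltjes measure of `rightLim F`:
  `μ_F` has no mass on `(-∞,0)`, an atom `F(0+)` at `0` and `dF` on `(0,∞)`; integration by parts
  gives `∫₀^∞ F k_γ = F(0+)/γ² + ∫_{(0,∞)} dF(s)/(γ²+s²)`, and the atom term is exactly the `s = 0`
  contribution of the left side. The would-be trap (an atom at `0⁺` when `F(0) = 0 < F(0+)`) is
  therefore handled correctly by the statement; values of `F` at its jumps are invisible to both sides.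
  TRUE (landed in `lintegral` form, which also covers unbounded `G`).
* A4 `stub_limitRepresentation` / the sketch's `limitData_of_subseq` — the limit `G` may be UNBOUNDED, but Fatou (`∫₀^∞ G k_γ ≤ L γ`) already
  gives `∫ dν_G(λ)/(γ²+λ) < ∞`, i.e. field 3 of `HasStieltjesRepresentation`; the near-zero piece
  `∫₀^δ F_k k_γ ≤ F_k(δ)·δ²/(γ²(γ²+δ²)) → 0` uniformly (one-friction a priori bound), so no mass is
  lost at `λ = 0` (mass sliding to `0⁺` becomes the atom `G(0+)` of `ν_G`, seen identically by both
  sides); the tail limit `e(γ) = L γ - ∫₀^∞ G k_γ ≥ 0` is `γ`-free by the kernel ratio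
  `k_γ/k_γ' → 1`; `q z := e + ∫ (λ - z)⁻¹ dν_G` then has data `(e, ν_G)` by definition. TRUE.
  (The §2 witness shows its conclusion cannot be pushed to convergence AT the jump of `G`.)
* Joint sufficiency `StieltjesContinuity ∧ 12238 ∧ 10924 ⊢ (M)` is kernel-checked in `SplitGlue.lean`
  (strategist b1); nothing is smuggled.
No stub kill is available on this line; the disprover's useful output for it is §1 (the proof MUST use
a uniqueness set of frictions — it does: all `γ > 0`, via `eqOn_of_hasStieltjesRepresentation_of_eqOn_neg`)
and §2 (the continuity-point proviso is sharp, so `eq_at_continuity_of_sqContactMeasure_eq` is the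
right last step, not a pointwise identification).

## 5. Near-misses / not attempted

* HARMONIC CORNER `lam = β = 0` (strategist N-3): with `0 ≤ lam, 0 ≤ β` admitted, (M) is false GIVEN
  the harmonic Stieltjes representation (finite-atom contact measure of `N`-bounded support and mass
  `≍ 1`, so `N·Φ_N(t) ≍ N` above the top atom; Rieder–Lebowitz–Lieb /
  `Barriers/AtomisticToContinuum/HarmonicCrystalBallistic*`). Not written: it needs K2 at the harmonic
  member for ALL `N` (the route's unlanded "Lean-sized calibration") plus weak-NESS uniqueness at
  `lam = β = 0` (`nessUnique_proof` is stated for `lam, β > 0`). Informative value low (every proof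
  uses `lam, β > 0` through the response clause anyway), cost high — parked.
* DROPPING `Monotone` / `Φ_N = 0 on (-∞,0]` / boundedness: each needs a representing family to exist
  (K2, physics) before a modification can be exhibited, except in the abstract stub currency, where
  `Monotone` is trivially load-bearing (`F_N = N·1_{{1}}` has zero transforms) and — remark for the
  stub's prover — the `= 0 on (-∞,0]` clause is probably NOT (convergence at two frictions already
  bounds `F_N(δ)` below; the limit data acquire an extra `-a/γ⁴` term that the uniqueness argument
  still separates). Boundedness is a junk-guard (`∫` of a non-integrable `Φ_N k_γ` is `0`).
* NO COMPUTE this cycle: every checkable claim above is kernel-checked; the physical sequence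
  `D_N(γ)` of the anharmonic chain is not computable to the precision a parity/drift effect in `N`
  would need, and by §3 such a computation would be an attack on the conjunct, filed under 9141/12238.
-/

end Summit.AtomisticToContinuum.FouriersLaw.Cruxes.ContactMeasureLimit.Disproof

end
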